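import Mathlib
import Summits.Ventures.PercRepro.PuncturedLYMFibrationOneArith

/-!
# PercRepro — THE FIBRATION OVER A MEMBER OF A MULTI-MEMBER NODE: THE SECOND FAMILY OF LAYER INEQUALITIES
(p10, gen 37)

At a node of the fibration recursion (pairwise disjoint members, member columns at demand `1`, free columns at `θ`,
uniform rows `ρ`) fibrated over a member `C` of size `m`, the fibres over the layers `a = 0 … m − 1` are the instances
of the OTHER members at level `ℓ − a`; write `r t` for their rows and `q t` for their member columns at level `t` (so
the free columns at level `t` are `r (t+1)`).  The layer counts are `Rn a = C(m,a)·r (ℓ−a)`, `Un a = C(m,a)·r (ℓ−a+1)`,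
`Qn a = C(m,a)·q (ℓ−a)`, the excesses `en a = ρ·Rn a − Qn a − θ·Un a`, the partial sums `Hn a = Σ_{b<a} en b`; the
constraints of the fibration are `0 ≤ Hn a` (the horizontal weights) and `Hn a ≤ θ·Un a` (the fibres' bases).
THEOREM (`second_family`): the SECOND family for every `1 ≤ a < m` follows from its two end cases alone — the LAYERED
adjacent-row condition `NC + Qn (m−1) ≤ ρ·Rn (m−1)` (the rows one short of `C` pay `C`'s member columns `NC` and the
other members' columns at that layer) and `Hn 1 ≤ θ·Un 1` (the horizontal weight out of layer `0` is at most `θ`) —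
by the reflected-steps argument of the one-member proof (PuncturedLYMFibrationOneLayers): the steps
`tn b = ρ·Rn b − Qn b − θ·Un (b+1) = C(m,b)·(r (ℓ−b)·(ρ − θ(m−b)/(b+1)) − q (ℓ−b))` change sign once PROVIDED the
ratio `q/r` (the other members' columns per row) is monotone in the level (`hq`; true on every family tested, a
lemma to prove for pairwise disjoint families).  Nothing here asserts the first family; `r`, `q` are arbitrary
sequences (every layer nonempty).
-/

namespace PercRepro.PuncturedLYM.Split.NodeArith

open Finset OneArith

/-- Rows of layer `a`. -/
def Rn (m ℓ : ℕ) (r : ℕ → ℚ) (a : ℕ) : ℚ := (m.choose a : ℚ) * r (ℓ - a)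

/-- Free columns of layer `a`. -/
def Un (m ℓ : ℕ) (r : ℕ → ℚ) (a : ℕ) : ℚ := (m.choose a : ℚ) * r (ℓ - a + 1)

/-- Member columns of the other members at layer `a`. -/
def Qn (m ℓ : ℕ) (q : ℕ → ℚ) (a : ℕ) : ℚ := (m.choose a : ℚ) * q (ℓ - a)

/-- The excess of layer `a`. -/
def en (m ℓ : ℕ) (ρ θ : ℚ) (r q : ℕ → ℚ) (a : ℕ) : ℚ :=
  ρ * Rn m ℓ r a - Qn m ℓ q a - θ * Un m ℓ r a

/-- The horizontal mass leaving the layers `< a`. -/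
def Hn (m ℓ : ℕ) (ρ θ : ℚ) (r q : ℕ → ℚ) (a : ℕ) : ℚ := ∑ b ∈ range a, en m ℓ ρ θ r q b

/-- The reflected step: the rows of layer `b` minus the other members' columns of layer `b` minus the free columns
of layer `b + 1`. -/
def tn (m ℓ : ℕ) (ρ θ : ℚ) (r q : ℕ → ℚ) (b : ℕ) : ℚ :=
  ρ * Rn m ℓ r b - Qn m ℓ q b - θ * Un m ℓ r (b + 1)

/-- The column-Hall slack of «`C`'s member columns, the other members' columns at the layers `≥ a`, and the free
columns above layer `a`» (`NC` = the demand of `C`'s member columns). -/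
def Gn (m ℓ : ℕ) (ρ θ : ℚ) (r q : ℕ → ℚ) (NC : ℚ) (a : ℕ) : ℚ :=
  θ * Un m ℓ r a + ∑ b ∈ Ico a m, en m ℓ ρ θ r q b - NC

section

variable {m ℓ : ℕ} {ρ θ : ℚ} {r q : ℕ → ℚ} {NC : ℚ}

/-- Nonnegativity of the steps is upward closed, provided the ratio `q/r` of the other members' columns to the rows
is monotone in the level (it decreases along the layers): with `X_b = ρ(b+1) − θ(m−b)`, `tn b ≥ 0 ⟺ r_b·X_b ≥ (b+1)·q_b`. -/
theorem tn_nonneg_mono (hmℓ : m ≤ ℓ) (hθ : 0 ≤ θ) (hr : ∀ c, c < m → 0 < r (ℓ - c))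
    (hq0 : ∀ c, c < m → 0 ≤ q (ℓ - c))
    (hq : ∀ c c', c ≤ c' → c' < m → q (ℓ - c') * r (ℓ - c) ≤ q (ℓ - c) * r (ℓ - c'))
    (b b' : ℕ) (hbb' : b ≤ b') (hb' : b' + 1 ≤ m) (h : 0 ≤ tn m ℓ ρ θ r q b) : 0 ≤ tn m ℓ ρ θ r q b' := by
  have hform : ∀ c, c + 1 ≤ m → tn m ℓ ρ θ r q c * (c + 1)
      = (m.choose c : ℚ) * (r (ℓ - c) * (ρ * (c + 1) - θ * ((m - c : ℕ) : ℚ)) - (c + 1) * q (ℓ - c)) := by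
    intro c hc
    unfold tn Rn Un Qn
    have e1 : ℓ - (c + 1) + 1 = ℓ - c := by omega
    rw [e1]
    have := choose_succ_right_eq_q m c
    linear_combination (-θ * r (ℓ - c)) * this
  have hb1 : (0 : ℚ) < b + 1 := by positivity
  have hb'1 : (0 : ℚ) < b' + 1 := by positivity
  have hmb : ((m - b' : ℕ) : ℚ) ≤ ((m - b : ℕ) : ℚ) := by exact_mod_cast Nat.sub_le_sub_left hbb' m
  have hbq : (b : ℚ) + 1 ≤ b' + 1 := by exact_mod_cast Nat.succ_le_succ hbb'
  have hcb : (0 : ℚ) < (m.choose b : ℚ) := by exact_mod_cast Nat.choose_pos (by omega)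
  have hcb' : (0 : ℚ) ≤ (m.choose b' : ℚ) := by positivity
  have hrb := hr b (by omega); have hrb' := hr b' (by omega)
  have hqb := hq0 b (by omega); have hqb' := hq0 b' (by omega)
  have hratio := hq b b' hbb' (by omega)
  -- (1) `r_b·X_b ≥ (b+1)·q_b`
  have h1 : (b + 1 : ℚ) * q (ℓ - b) ≤ r (ℓ - b) * (ρ * (b + 1) - θ * ((m - b : ℕ) : ℚ)) := by
    have h0 : 0 ≤ tn m ℓ ρ θ r q b * (b + 1) := mul_nonneg h hb1.le
    rw [hform b (by omega)] at h0
    by_contra hneg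
    push Not at hneg
    have hlt : r (ℓ - b) * (ρ * (b + 1) - θ * ((m - b : ℕ) : ℚ)) - (b + 1) * q (ℓ - b) < 0 := by linarith
    have := mul_neg_of_pos_of_neg hcb hlt
    linarith
  -- (2) `(b+1)·X_{b'} ≥ (b'+1)·X_b`
  have h2 : (b' + 1 : ℚ) * (ρ * (b + 1) - θ * ((m - b : ℕ) : ℚ))
      ≤ (b + 1 : ℚ) * (ρ * (b' + 1) - θ * ((m - b' : ℕ) : ℚ)) := by
    have hm0 : (0 : ℚ) ≤ ((m - b' : ℕ) : ℚ) := by positivity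
    nlinarith [mul_le_mul_of_nonneg_left hmb hθ, mul_le_mul_of_nonneg_left hbq (mul_nonneg hθ hm0)]
  -- the goal multiplied by `(b+1)·r_b > 0`
  have hgoal : (b' + 1 : ℚ) * q (ℓ - b') * ((b + 1) * r (ℓ - b))
      ≤ r (ℓ - b') * (ρ * (b' + 1) - θ * ((m - b' : ℕ) : ℚ)) * ((b + 1) * r (ℓ - b)) := by
    have hA : (b' + 1 : ℚ) * q (ℓ - b') * ((b + 1) * r (ℓ - b)) ≤ (b' + 1 : ℚ) * q (ℓ - b) * ((b + 1) * r (ℓ - b')) := by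
      have := mul_le_mul_of_nonneg_left hratio (by positivity : (0 : ℚ) ≤ (b' + 1) * (b + 1))
      linarith [this]
    have hB : (b' + 1 : ℚ) * q (ℓ - b) * ((b + 1) * r (ℓ - b')) ≤ (b' + 1 : ℚ) * r (ℓ - b') * (r (ℓ - b) * (ρ * (b + 1) - θ * ((m - b : ℕ) : ℚ))) := by
      have := mul_le_mul_of_nonneg_left h1 (by positivity : (0 : ℚ) ≤ (b' + 1) * r (ℓ - b'))
      linarith [this]
    have hC : (b' + 1 : ℚ) * r (ℓ - b') * (r (ℓ - b) * (ρ * (b + 1) - θ * ((m - b : ℕ) : ℚ)))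
        ≤ r (ℓ - b') * (ρ * (b' + 1) - θ * ((m - b' : ℕ) : ℚ)) * ((b + 1) * r (ℓ - b)) := by
      have := mul_le_mul_of_nonneg_left h2 (mul_nonneg hrb'.le hrb.le)
      linarith [this]
    linarith
  have hpos : (0 : ℚ) < (b + 1) * r (ℓ - b) := by positivity
  have h3 : (b' + 1 : ℚ) * q (ℓ - b') ≤ r (ℓ - b') * (ρ * (b' + 1) - θ * ((m - b' : ℕ) : ℚ)) :=
    le_of_mul_le_mul_right hgoal hpos
  have h4 : 0 ≤ tn m ℓ ρ θ r q b' * (b' + 1) := by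
    rw [hform b' hb']
    apply mul_nonneg hcb'
    linarith
  exact nonneg_of_mul_nonneg_left h4 hb'1

/-- `Hn a ≤ θ·Un a ⟺ 0 ≤ Gn a` (`a ≤ m`), given `Hn m = NC`. -/
theorem Hn_le_iff_Gn (htot : Hn m ℓ ρ θ r q m = NC) (a : ℕ) (ha : a ≤ m) :
    Hn m ℓ ρ θ r q a ≤ θ * Un m ℓ r a ↔ 0 ≤ Gn m ℓ ρ θ r q NC a := by
  have hsplit := sum_range_add_sum_Ico (en m ℓ ρ θ r q) ha
  unfold Hn at htot ⊢
  unfold Gn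
  constructor <;> intro h <;> linarith

/-- `Gn a = Gn (a+1) + tn a`. -/
theorem Gn_succ (a : ℕ) (ha : a + 1 ≤ m) :
    Gn m ℓ ρ θ r q NC a = Gn m ℓ ρ θ r q NC (a + 1) + tn m ℓ ρ θ r q a := by
  unfold Gn tn
  rw [sum_eq_sum_Ico_succ_bot (show a < m by omega) (en m ℓ ρ θ r q)]
  unfold en
  ring

/-- `Gn a = Gn (m−1) + Σ_{b ∈ Ico a (m−1)} tn b`. -/
theorem Gn_eq_tail (hm : 1 ≤ m) (a : ℕ) (ha : a ≤ m - 1) :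
    Gn m ℓ ρ θ r q NC a = Gn m ℓ ρ θ r q NC (m - 1) + ∑ b ∈ Ico a (m - 1), tn m ℓ ρ θ r q b := by
  obtain ⟨d, hd⟩ : ∃ d, a + d = m - 1 := ⟨m - 1 - a, by omega⟩
  induction d generalizing a with
  | zero =>
    have : a = m - 1 := by omega
    subst this; simp
  | succ d ih =>
    have h1 := Gn_succ (m := m) (ℓ := ℓ) (ρ := ρ) (θ := θ) (r := r) (q := q) (NC := NC) a (by omega)
    have h2 := ih (a + 1) (by omega) (by omega)
    rw [h1, h2, sum_eq_sum_Ico_succ_bot (show a < m - 1 by omega)]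
    ring

/-- `Gn (m−1) = ρ·Rn (m−1) − Qn (m−1) − NC`: the layered adjacent-row slack. -/
theorem Gn_pred (hm : 1 ≤ m) :
    Gn m ℓ ρ θ r q NC (m - 1) = ρ * Rn m ℓ r (m - 1) - Qn m ℓ q (m - 1) - NC := by
  unfold Gn
  have : Ico (m - 1) m = {m - 1} := by
    ext b; simp only [mem_Ico, mem_singleton]; omega
  rw [this, sum_singleton]
  unfold en
  ring

/-- **THE SECOND FAMILY AT A MULTI-MEMBER NODE.** If every layer is nonempty, `θ ≥ 0`, the ratio `q/r` is monotone in the level, `Hn m = NC` (the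
totals), the layered adjacent-row condition `NC + Qn (m−1) ≤ ρ·Rn (m−1)` holds and `Hn 1 ≤ θ·Un 1` (the horizontal
weight out of layer `0` is at most `θ`), then `Hn a ≤ θ·Un a` for every `1 ≤ a < m`. -/
theorem second_family (hm : 1 ≤ m) (hmℓ : m ≤ ℓ) (hθ : 0 ≤ θ) (hr : ∀ c, c < m → 0 < r (ℓ - c))
    (hq0 : ∀ c, c < m → 0 ≤ q (ℓ - c))
    (hq : ∀ c c', c ≤ c' → c' < m → q (ℓ - c') * r (ℓ - c) ≤ q (ℓ - c) * r (ℓ - c'))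
    (htot : Hn m ℓ ρ θ r q m = NC) (histar : NC + Qn m ℓ q (m - 1) ≤ ρ * Rn m ℓ r (m - 1))
    (hone : Hn m ℓ ρ θ r q 1 ≤ θ * Un m ℓ r 1) :
    ∀ a, 1 ≤ a → a < m → Hn m ℓ ρ θ r q a ≤ θ * Un m ℓ r a := by
  intro a ha1 ham
  rw [Hn_le_iff_Gn htot a ham.le]
  rw [Gn_eq_tail (by omega) a (by omega)]
  have hrefl : ∀ a', a' ≤ m - 1 → ∑ b ∈ Ico a' (m - 1), tn m ℓ ρ θ r q b
      = ∑ c ∈ range (m - 1 - a'), tn m ℓ ρ θ r q (m - 2 - c) := by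
    intro a' ha'
    rw [sum_Ico_eq_sum_range, ← sum_range_reflect]
    apply sum_congr rfl
    intro c hc
    rw [mem_range] at hc
    congr 1
    omega
  rw [hrefl a (by omega)]
  have hmono : ∀ c c', c ≤ c' → c' < m - 2 → 0 ≤ tn m ℓ ρ θ r q (m - 2 - c') → 0 ≤ tn m ℓ ρ θ r q (m - 2 - c) := by
    intro c c' hcc' hc' h
    exact tn_nonneg_mono hmℓ hθ hr hq0 hq (m - 2 - c') (m - 2 - c) (by omega) (by omega) h
  have hmin := sum_range_ge_min_zero (fun c => tn m ℓ ρ θ r q (m - 2 - c)) (m - 2) hmono (m - 1 - a) (by omega)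
  have hG1 : Gn m ℓ ρ θ r q NC 1 = Gn m ℓ ρ θ r q NC (m - 1) + ∑ c ∈ range (m - 2), tn m ℓ ρ θ r q (m - 2 - c) := by
    rw [Gn_eq_tail (by omega) 1 (by omega), hrefl 1 (by omega)]
    rw [show m - 1 - 1 = m - 2 by omega]
  have hGpred : 0 ≤ Gn m ℓ ρ θ r q NC (m - 1) := by
    rw [Gn_pred (by omega)]
    linarith
  have hGone : 0 ≤ Gn m ℓ ρ θ r q NC 1 := (Hn_le_iff_Gn htot 1 (by omega)).1 hone
  rcases le_or_gt (0 : ℚ) (∑ c ∈ range (m - 2), tn m ℓ ρ θ r q (m - 2 - c)) with hs | hs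
  · rw [min_eq_left hs] at hmin
    linarith
  · rw [min_eq_right hs.le] at hmin
    linarith

end

end PercRepro.PuncturedLYM.Split.NodeArith
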